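import Literature.Computability.Complexity.GateEliminationSubst

/-!
# Gate elimination: the quadratic substitution on rdq-sources (`assignQuad`)

Source side of the fourth substitution of Li–Yang (STOC 2022; full version ECCC TR21-023, §2.4
"Quadratic substitution. Let `x_j, x_i, x_k` be unprotected free variables. We can substitute
`x_j ← ((x_i ⊕ c₁) ∧ (x_k ⊕ c₂)) ⊕ c₃` for constants `c₁, c₂` and `c₃`, if it is possible to make
`x_j` a `0`-variable after appropriate rewiring. Similarly, `x_j` becomes a quadratic variable.
It is easy to see that the equations containing `x_j` at the right-hand sides are still valid"),
used once in the proof of the one-step claim `LiYang2022_step` (§4.1, Case 5.4.1.4: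
`z ← ((x ⊕ c₁) ∧ (y ⊕ c₂)) ⊕ c₃` so that the ⊕-type gate `D = G ⊕ z` becomes a constant), in the
style of `RdqSource.assignFree` / `RdqSource.assignLin`. Everything is PROVED.

* `RdqSource.assignQuad R z e …` — the free unprotected variable `x_z` becomes quadratic with the
  equation `e : x_z = ((x_{e.i} ⊕ c₁) ∧ (x_{e.k} ⊕ c₂)) ⊕ c₃` over two distinct free unprotected
  variables other than `x_z`; affine equations are unchanged (their right-hand sides may mention
  `x_z`, now a quadratic variable, which Def. 2.2 allows).
* `free_assignQuad_iff` (`x_z` is no longer free, nothing else changes), `dim_assignQuad`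
  (`dim' + 1 = dim`), `quadCount_assignQuad` (`q' = q + 1`), `protected_assignQuad_iff` (the
  protected variables afterwards: the old ones and `x_{e.i}`, `x_{e.k}`),
  `mem_sol_assignQuad_iff` / `sol_assignQuad` (`Sol' = Sol ∩ {x_z = e}`).

The circuit side of Case 5.4.1.4 (the only reader `D` of `z` computes the constant `b` on
`Sol R'` and is replaced by it, after which `z` is a `0`-variable) is ordinary rewiring
(`GateEliminationRules*.lean`) and is not repeated here.

## References

* J. Li, T. Yang, *3.1n − o(n) circuit lower bounds for explicit functions*, STOC 2022
  [LiYang2022]; full version ECCC TR21-023, Def. 2.2, §2.4 (Quadratic substitution), Prop. 2.6,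
  §4.1 (Case 5.4.1.4).
-/

namespace Literature.Computability.Complexity

open Finset

namespace RdqSource

variable {n : ℕ} (R : RdqSource n)

/-- The rdq-source after the **quadratic substitution `x_z := ((x_{e.i} ⊕ c₁) ∧ (x_{e.k} ⊕ c₂)) ⊕ c₃`**
(Li–Yang §2.4): `x_z`, `x_{e.i}`, `x_{e.k}` are pairwise distinct unprotected free variables;
`x_z` becomes quadratic with the equation `e`, everything else is kept.
[cite: LiYang2022, §2.4 (Quadratic substitution)] -/
def assignQuad (z : Fin n) (e : QuadEq n) (hz : R.Free z) (hzp : ¬ R.Protected z)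
    (hi : R.Free e.i) (hip : ¬ R.Protected e.i) (hk : R.Free e.k) (hkp : ¬ R.Protected e.k)
    (hik : e.i ≠ e.k) (hzi : z ≠ e.i) (hzk : z ≠ e.k) : RdqSource n where
  lin := R.lin
  quad j := if j = z then some e else R.quad j
  lin_or_quad j := by
    by_cases h : j = z
    · exact Or.inl (h ▸ hz.1)
    · rcases R.lin_or_quad j with h' | h'
      · exact Or.inl h'
      · exact Or.inr (by rw [if_neg h]; exact h')
  lin_wf := R.lin_wf
  quad_wf j e' h := by
    by_cases hj : j = z
    · subst hj
      rw [if_pos rfl, Option.some.injEq] at h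
      subst h
      refine ⟨⟨hi.1, ?_⟩, ⟨hk.1, ?_⟩, hik⟩
      · rw [if_neg (Ne.symm hzi)]; exact hi.2
      · rw [if_neg (Ne.symm hzk)]; exact hk.2
    · rw [if_neg hj] at h
      have hw := R.quad_wf j e' h
      have hiz : e'.i ≠ z := fun h' => hzp (protected_of_reads h (Or.inl h'))
      have hkz : e'.k ≠ z := fun h' => hzp (protected_of_reads h (Or.inr h'))
      refine ⟨⟨hw.1.1, ?_⟩, ⟨hw.2.1.1, ?_⟩, hw.2.2⟩
      · rw [if_neg hiz]; exact hw.1.2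
      · rw [if_neg hkz]; exact hw.2.1.2
  read_once j j' e₁ e₂ h h' hjj := by
    by_cases hj : j = z
    · subst hj
      rw [if_pos rfl, Option.some.injEq] at h
      subst h
      rw [if_neg (Ne.symm hjj)] at h'
      -- `e₂` is an old equation: it reads neither `e₁.i` nor `e₁.k` (they are unprotected)
      refine ⟨fun h₁ => hip (protected_of_reads h' (Or.inl h₁.symm)),
        fun h₁ => hip (protected_of_reads h' (Or.inr h₁.symm)),
        fun h₁ => hkp (protected_of_reads h' (Or.inl h₁.symm)),
        fun h₁ => hkp (protected_of_reads h' (Or.inr h₁.symm))⟩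
    · rw [if_neg hj] at h
      by_cases hj' : j' = z
      · subst hj'
        rw [if_pos rfl, Option.some.injEq] at h'
        subst h'
        refine ⟨fun h₁ => hip (protected_of_reads h (Or.inl h₁)),
          fun h₁ => hkp (protected_of_reads h (Or.inl h₁)),
          fun h₁ => hip (protected_of_reads h (Or.inr h₁)),
          fun h₁ => hkp (protected_of_reads h (Or.inr h₁))⟩
      · rw [if_neg hj'] at h'
        exact R.read_once j j' e₁ e₂ h h' hjj

section AssignQuad

variable {R}
variable {z : Fin n} {e : QuadEq n} (hz : R.Free z) (hzp : ¬ R.Protected z)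
  (hi : R.Free e.i) (hip : ¬ R.Protected e.i) (hk : R.Free e.k) (hkp : ¬ R.Protected e.k)
  (hik : e.i ≠ e.k) (hzi : z ≠ e.i) (hzk : z ≠ e.k)

/-- Affine equations are unchanged by `assignQuad`. [folklore] -/
@[simp] theorem assignQuad_lin : (R.assignQuad z e hz hzp hi hip hk hkp hik hzi hzk).lin = R.lin := rfl

/-- Quadratic equations after `assignQuad`: the new one at `z`. [folklore] -/
theorem assignQuad_quad (j : Fin n) :
    (R.assignQuad z e hz hzp hi hip hk hkp hik hzi hzk).quad j = if j = z then some e else R.quad j := rfl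

/-- The new quadratic equation. [folklore] -/
theorem assignQuad_quad_self : (R.assignQuad z e hz hzp hi hip hk hkp hik hzi hzk).quad z = some e := by
  rw [assignQuad_quad, if_pos rfl]

/-- The other quadratic equations. [folklore] -/
theorem assignQuad_quad_of_ne {j : Fin n} (h : j ≠ z) :
    (R.assignQuad z e hz hzp hi hip hk hkp hik hzi hzk).quad j = R.quad j := by
  rw [assignQuad_quad, if_neg h]

/-- **Free variables after `assignQuad`**: all but `x_z`. [cite: LiYang2022, §2.4] -/
theorem free_assignQuad_iff (j : Fin n) :
    (R.assignQuad z e hz hzp hi hip hk hkp hik hzi hzk).Free j ↔ R.Free j ∧ j ≠ z := by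
  unfold Free
  rw [assignQuad_lin, assignQuad_quad]
  by_cases hj : j = z
  · subst hj; simp
  · simp [hj]

/-- **`assignQuad` lowers the dimension by one.** [cite: LiYang2022, §2.4] -/
theorem dim_assignQuad : (R.assignQuad z e hz hzp hi hip hk hkp hik hzi hzk).dim + 1 = R.dim := by
  unfold dim
  have h1 : (univ.filter fun j => (R.assignQuad z e hz hzp hi hip hk hkp hik hzi hzk).Free j) =
      (univ.filter fun j => R.Free j).erase z := by
    ext j
    simp only [mem_filter, mem_univ, true_and, mem_erase, free_assignQuad_iff]
    tauto
  rw [h1, card_erase_add_one]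
  simpa using hz

/-- **`assignQuad` adds one quadratic equation.** [cite: LiYang2022, §2.4] -/
theorem quadCount_assignQuad :
    (R.assignQuad z e hz hzp hi hip hk hkp hik hzi hzk).quadCount = R.quadCount + 1 := by
  unfold quadCount
  have h1 : (univ.filter fun j => ((R.assignQuad z e hz hzp hi hip hk hkp hik hzi hzk).quad j).isSome) =
      insert z (univ.filter fun j => (R.quad j).isSome) := by
    ext j
    simp only [mem_filter, mem_univ, true_and, mem_insert, assignQuad_quad]
    by_cases hj : j = z
    · subst hj; simp
    · simp [hj]
  rw [h1, card_insert_of_notMem]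
  simp [hz.2]

/-- **Protected variables after `assignQuad`**: the old ones, and the two variables of the new
equation. [cite: LiYang2022, §2.3, §2.4] -/
theorem protected_assignQuad_iff (j : Fin n) :
    (R.assignQuad z e hz hzp hi hip hk hkp hik hzi hzk).Protected j ↔ R.Protected j ∨ j = e.i ∨ j = e.k := by
  unfold Protected
  rw [free_assignQuad_iff]
  constructor
  · rintro ⟨⟨hf, hjz⟩, l, e', hl, hr⟩
    by_cases hlz : l = z
    · subst hlz
      rw [assignQuad_quad_self, Option.some.injEq] at hl
      subst hl
      rcases hr with h | h
      · exact Or.inr (Or.inl h.symm)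
      · exact Or.inr (Or.inr h.symm)
    · rw [assignQuad_quad_of_ne _ _ _ _ _ _ _ _ _ hlz] at hl
      exact Or.inl ⟨hf, l, e', hl, hr⟩
  · rintro (⟨hf, l, e', hl, hr⟩ | rfl | rfl)
    · have hlz : l ≠ z := fun h => by rw [h, hz.2] at hl; exact Option.some_ne_none _ hl.symm
      have hjz : j ≠ z := fun h => hzp (h ▸ ⟨hf, l, e', hl, hr⟩)
      exact ⟨⟨hf, hjz⟩, l, e', by rw [assignQuad_quad_of_ne _ _ _ _ _ _ _ _ _ hlz]; exact hl, hr⟩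
    · exact ⟨⟨hi, hzi.symm⟩, z, e, assignQuad_quad_self _ _ _ _ _ _ _ _ _, Or.inl rfl⟩
    · exact ⟨⟨hk, hzk.symm⟩, z, e, assignQuad_quad_self _ _ _ _ _ _ _ _ _, Or.inr rfl⟩

/-- Old protected variables stay protected. [folklore] -/
theorem protected_assignQuad_of_protected {j : Fin n} (h : R.Protected j) :
    (R.assignQuad z e hz hzp hi hip hk hkp hik hzi hzk).Protected j :=
  (protected_assignQuad_iff hz hzp hi hip hk hkp hik hzi hzk j).mpr (Or.inl h)

/-- **Solutions after `assignQuad`**: the old solutions with `x_z = ((x_i + c₁)(x_k + c₂)) + c₃`.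
[cite: LiYang2022, §2.4, Prop. 2.6] -/
theorem mem_sol_assignQuad_iff (v : Fin n → ZMod 2) :
    v ∈ (R.assignQuad z e hz hzp hi hip hk hkp hik hzi hzk).Sol ↔ v ∈ R.Sol ∧ v z = e.eval v := by
  rw [mem_sol_iff, mem_sol_iff]
  simp only [assignQuad_lin]
  constructor
  · rintro ⟨hlin, hquad⟩
    refine ⟨⟨hlin, fun j e' hj => ?_⟩, hquad z e (assignQuad_quad_self _ _ _ _ _ _ _ _ _)⟩
    have hjz : j ≠ z := fun h => by rw [h, hz.2] at hj; exact Option.some_ne_none _ hj.symm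
    exact hquad j e' (by rw [assignQuad_quad_of_ne _ _ _ _ _ _ _ _ _ hjz]; exact hj)
  · rintro ⟨⟨hlin, hquad⟩, hvz⟩
    refine ⟨hlin, fun j e' hj => ?_⟩
    by_cases hjz : j = z
    · subst hjz
      rw [assignQuad_quad_self, Option.some.injEq] at hj
      subst hj
      exact hvz
    · rw [assignQuad_quad_of_ne _ _ _ _ _ _ _ _ _ hjz] at hj
      exact hquad j e' hj

/-- Solutions after `assignQuad`, as a set. [cite: LiYang2022, §2.4, Prop. 2.6] -/
theorem sol_assignQuad :
    (R.assignQuad z e hz hzp hi hip hk hkp hik hzi hzk).Sol = R.Sol ∩ {v | v z = e.eval v} :=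
  Set.ext fun v => mem_sol_assignQuad_iff hz hzp hi hip hk hkp hik hzi hzk v

/-- The solution set shrinks. [cite: LiYang2022, Prop. 2.6] -/
theorem sol_assignQuad_subset : (R.assignQuad z e hz hzp hi hip hk hkp hik hzi hzk).Sol ⊆ R.Sol := by
  rw [sol_assignQuad]; exact Set.inter_subset_left

end AssignQuad

end RdqSource

end Literature.Computability.Complexity
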